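import Mathlib
import HarnessLib
import HarnessLib.Audit
import Summits.AtomisticToContinuum.Statement
import Literature.MathematicalPhysics.QuantumManyBody.PeriodicBoseGas
import Literature.Probability.Process.BrownianVec

/-!
Route: BECImaginaryTimeTransport

CLOSED (retired) 2026-08-15T13:39:01Z by operator:999:1257524 — reason: not-a-thesis: assembly does not conclude the sub-problem Statement — note: D-0027 §2.1 audit (human 2026-08-15: routes that do not decide the summit are removed): the assembly concludes `Literature.MathematicalPhysics.QuantumManyBody.BoseGas.BoseEinsteinCondensation`, not the sub-problem statement; a NEW conforming route may be opened from the same idea (generated `closes . The file is kept as the record of this route; refuted decls are indexed as negative knowledge (`ledger negatives`).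

# Route BECImaginaryTimeTransport — BEC by transporting mode occupations along the explicit
imaginary-time Feynman–Kac flow with exact covariance identities and shell-wise relaxation times

X_T (COVARIANCE TRANSPORT ALONG THE IMAGINARY-TIME FLOW; realises card
imaginary-time-flow-covariance-transport). Let Φ_t := e^{-tH_N}Φ₀ on the Dirichlet box of side L =
(N/ρ)^{1/3}, Φ₀ = φ₁^{⊗N} the product of one-body ground modes, written as the explicit Feynman–Kac
expectation over N independent Brownian motions killed at ∂Λ_L (typed over any
`Literature.Probability.Process.IsBrownianVec` model; ħ = 2m = 1, c = √(16πρa), κ = 1/ξ = √(8πρa), a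
= scattering length). It suffices to show three A-PRIORI BOUNDS on this explicit family, uniform in
L for ρ < ρ₀(v): X_T = EnergyVarianceDecay ∧ SoftShellRelaxation ∧ HardModeBounds — (C1) the energy
variance Var_t(H) = ¼(log‖Φ_t‖²)'' decays like C L³c⁻³t⁻⁵ for t ≳ c⁻²; (C2) every dyadic momentum
shell (k_j/2, k_j] of Dirichlet sine modes, k_j = 2⁻ʲκ, has occupation ≤ C L³ c k_j² and number
variance ≤ C L³c²k_j from its own relaxation time T_j = 1/(ck_j) on; (C3) the hard modes |k| > κ
carry ≤ C N√(ρa³) particles with variance ≤ CN from t ≳ c⁻² on. The exact identities d⟨A⟩_t/dt =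
−2Re Cov_t(H,A), |Cov| ≤ σ(H)σ(A), applied shell by shell from T_j and telescoped over shells
(TransportBookkeeping, with the abstract CovarianceTransportLemma) give ground-mode occupation ≥ N(1
− C(ρa³)^{1/4}) for the ground state reached by the flow, i.e. the flow-free typed target
FlowCondensation (item 0: at every precision δ there are δ-near-minimisers with occupation ≥ cN of
one mode); NearMinimiserCoherence (fixed-N uniqueness/stability of near-minimisers) upgrades "some
near-minimisers" to "all", which is the conjunct.
Lean: `EnergyVarianceDecay ∧ SoftShellRelaxation ∧ HardModeBounds` (route decls below, each a closed
one-line Prop over Literature.MathematicalPhysics.QuantumManyBody.BoseGas.{IsRepulsiveFiniteRange,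
sideLength, scatteringLength, Config, boxN, interaction, occupation} and
Literature.Probability.Process.IsBrownianVec; typed flow-free consequence = FlowCondensation)

## Assembly
FlowCondensation gives, eventually in N, a mode u and condensing δ-near-minimisers for every δ;
NearMinimiserCoherence with ε = c/2 gives δ such that EVERY δ-near-minimiser Ψ' has occupation ≥
occupation(Ψ) − cN/2 ≥ cN/2 (ENNReal arithmetic with ofReal); `occupation_le_maxOccupation` and
`le_condensateNumber` give condensateNumber ≥ ofReal((c/2)N), i.e. HasGroundStateBEC v ρ for ρ < min
of the ρ₀'s, hence the conjunct. ~80 lines, standard reductions only.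

Rationale: WHY THIS LINE. Every rigorous passage "finite object ⇒ ground-state condensation" in print is
gap-based (depletion ≤ L² × excess energy: LiebSeiringerSolovejYngvason2005 Thm 5.1, Fournais2020,
Junge2026 = arXiv:2603.20776) and stops at boxes tied to the density (barrier
KineticGapLengthScales). This line replaces the gap by TIME: integrate the exact pure-state identity
d⟨A⟩_t/dt = −2Re Cov_t(H,A) along Φ_t = e^{-tH}Φ₀ from an explicit product state, so that the ground
state enters only as t → ∞ and L enters only through the convergence of a dyadic shell sum, which
the linear phonon dispersion makes uniform (each shell costs ∼ L³ck_j², summable in j; the naive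
one-shot version fails by the Giorgini–Pitaevskii–Stringari pseudo-thermal anomaly,
GiorginiPitaevskiiStringari1998, and the shell-wise start times are the repair recorded on the
card). Imported areas: stochastic analysis / Feynman–Kac (the flow is a Wiener expectation over N
independent Brownian motions with killing — Ginibre1965 technology, AdamsBruKonig2006/AdamsKonig2007
for the same path family at the energy level), projector quantum Monte Carlo lore (local-energy
variance decay: BaroniMoroni1999, SarsaSchmidtMagro2000), and Bogoliubov phonon kinematics only as
the bookkeeping that fixes the shell times. What it does that prior routes do not: no coercivity or
n₊-penalty (BECPinning), no infrared bound on near-minimisers as hypothesis (BECInfraredBound), no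
boundary-condition transfer (BECPeriodicReduction), no complex effective action (BECRenormGroup);
unlike card heating-only-depletes-thermal-bridge (thermal covariance ⟨H;N₀⟩_β with a conjectured
SIGN) it uses the pure-state covariance with Cauchy–Schwarz and integrable decay, no sign. Negatives
index: empty at filing.

RANKED CRUXES. #0 FlowCondensation (target) — X_T's flow-free typed consequence: for every repulsive
finite-range v there is ρ₀ > 0 such that for 0 < ρ < ρ₀ there is c > 0 with, for all large N, ONE
normalised measurable mode u such that for every δ > 0 some δ-near-minimiser Ψ of the Dirichlet
N-body energy in the box of side (N/ρ)^{1/3} has ⟨u, γ_Ψ u⟩ ≥ cN (the ground state reached by the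
flow condenses; u = the one-body Dirichlet ground mode in the intended proof). (why it might fail:
it is ground-state BEC itself for the Perron–Frobenius ground state (open 75+ years); fails if the
thermodynamic-limit ground state of some admissible v at small ρ is a fragmented/quantum-solid
state.) [LiebSeiringerSolovejYngvason2005, Junge2026, arXiv:2510.20493]
#2 EnergyVarianceDecay (crux) — (card C1) ENERGY-VARIANCE DECAY ALONG THE FLOW. For every repulsive
finite-range v there are C, ρ₀ > 0 such that for 0 < ρ < ρ₀, all large N and EVERY 3N-dimensional
Brownian model W: with L = (N/ρ)^{1/3}, c = √(16πρa), Φ_t(X) = E[1{X+√2W_s ∈ Λ_L^N ∀s≤t} · exp(−∫₀ᵗ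
Σ_{i<j} v(|x_i−x_j|)(X+√2W_s) ds) · Φ₀(X+√2W_t)] (killed on hard cores: weight 0 when the time
integral is ∞), Φ₀ = ∏ √(2/L) sin(πx_{ik}/L), and Z(t) = ‖Φ_t‖²₂: for all t ≥ C c⁻², Var_t(H) = ¼
(log Z)''(t) ≤ C L³ c⁻³ t⁻⁵. (Bogoliubov heuristic: each unrelaxed phonon mode ck ≲ 1/t is
pseudo-thermal at T_eff = 1/(4t) and contributes 1/(4t²); there are ∼ (L/(ct))³ of them.)
[difficulty: XL] (why it might fail: a two-sided statement on the spectral measure of the product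
state far beyond the cluster radius ρat ≲ 1; an anomalously slow non-phonon soft branch, or
L-dependent prefactors (L⁴ instead of L³) from condensate-number fluctuations, would break it.)
[BaroniMoroni1999, SarsaSchmidtMagro2000, GiorginiPitaevskiiStringari1998,
LiebSeiringerSolovejYngvason2005, Ginibre1965]
#3 SoftShellRelaxation (crux) — (card C2, soft part) SHELL RELAXATION STATISTICS. Same flow (N = M+2
≥ 2), κ = √(8πρa), Dirichlet sine modes φ_n (n ∈ ℕ₊³, |k_n| = π|n|/L), dyadic shells B_j = {n ≠
(1,1,1) : k_j/2 < |k_n| ≤ k_j}, k_j = 2⁻ʲκ: for every j, every finite S ⊆ B_j and all t ≥ C/(ck_j):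
⟨N_S⟩_t ≤ C L³ c k_j² and ⟨N_S²⟩_t ≤ ⟨N_S⟩_t² + C L³ c² k_j, where N_S = Σ_i P_S^{(i)} is written
through `occupation` (one-body) and the explicit two-body pair occupation, both normalised by Z(t).
[difficulty: XL] (why it might fail: needs Bogoliubov-size occupations AND normal
(non-pseudo-thermal) number variances of every relaxed shell of an explicit but non-perturbative
state, uniformly down to k ∼ π/L; inter-shell coupling through the still-unrelaxed lower shells
could inflate variances.) [GiorginiPitaevskiiStringari1998, LiebSeiringerSolovejYngvason2005,
FournaisSolovej2020, Junge2026]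
#4 HardModeBounds (crux) — (card C2 hard part / C3 output) HARD-MODE BOUNDS. Same flow and modes:
for every finite S ⊆ {n ≠ (1,1,1) : |k_n| > κ} and all t ≥ C c⁻²: ⟨N_S⟩_t ≤ C N √(ρa³) and ⟨N_S²⟩_t
≤ ⟨N_S⟩_t² + C N. Expected mechanism up to t ≈ ξ²: a Ginibre-type cluster expansion of the 2t-long
interacting Brownian paths with product initial law (small parameter = expected number of distinct
partners met = ρat, Boltzmann statistics — no permutations since Φ₀ is symmetric), which also yields
E_t to LHY precision; beyond ξ² an a-priori bound. [difficulty: XL] (why it might fail: uniformity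
in t beyond the cluster-expansion radius ρat ≲ 1 is unproved; the LHY-size depletion N√(ρa³) of the
hard modes must not be transiently exceeded while the soft shells relax.) [Ginibre1965,
AdamsBruKonig2006, FournaisSolovej2020, LiebSeiringerSolovejYngvason2005]
#9 CovarianceTransportLemma (support) — (card S1, abstract engine) finite-dimensional covariance
transport: for self-adjoint H, A on a finite-dimensional complex Hilbert space and Φ_t = e^{-tH}Φ₀
(Φ₀ ≠ 0), the normalised expectation ⟨A⟩_t satisfies |⟨A⟩_{T₂} − ⟨A⟩_{T₁}| ≤ 2∫_{T₁}^{T₂}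
σ_t(H)σ_t(A) dt (d⟨A⟩_t/dt = −2Re Cov_t(H,A) and Cauchy–Schwarz). [difficulty: provable-now]
[BaroniMoroni1999, LiebSeiringerSolovejYngvason2005]
#9 BrownianModelExists (support) — non-vacuity of the flow cruxes (they quantify over all models):
for every d there is a probability space carrying a d-dimensional Brownian motion in the sense of
`IsBrownianVec` (product of d canonical Wiener spaces, as `BrownianVecModel` does for d = 4).
[difficulty: provable-now] [arXiv:2511.20118, Kallenberg2002]
#9 NearMinimiserCoherence (support) — (card S2, identification) at fixed large N and small ρ the
Dirichlet ground state is unique and near-minimisers are stable: for every normalised measurable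
mode u and ε > 0 there is δ > 0 such that any two δ-near-minimisers have u-occupations within εN (E₀
< ⊤ by disjoint bumps; compact resolvent; positivity-improving FK semigroup on the uncaged
component; occupation is 2N-Lipschitz in L²). [difficulty: M] [LiebSeiringerSolovejYngvason2005,
ReedSimon1978]
#9 TransportBookkeeping (support) — (card S1+S2, the bookkeeping theorem) EnergyVarianceDecay →
SoftShellRelaxation → HardModeBounds → FlowCondensation: the FK expectation is the Dirichlet-form
semigroup e^{-tH_N}Φ₀ (so (log Z)'' = 4Var_t(H), d⟨N_S⟩_t/dt = −2Re Cov_t(H,N_S)); apply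
CovarianceTransportLemma (via spectral truncation / dominated convergence) to each shell from
max(T_j, Cc⁻²) and to the hard part, telescope N = N_u + Σ_j N_{B_j} + N_hard over the sine basis (u
= φ_(1,1,1)), sum the geometric series Σ_j L³ck_j² = O(N√(ρa³)) plus the hard cost O(N(ρa³)^{1/4}),
let t → ∞ (Φ_t/‖Φ_t‖ → Ψ₀, E_t ↓ groundStateEnergy since ⟨Φ₀,Ψ₀⟩ > 0 and the C¹ Dirichlet class is a
form core), and approximate Ψ₀ in form norm by TrialStates. Instantiate the ∀-model cruxes with
BrownianModelExists. [difficulty: XL] [Ginibre1965, LiebSeiringerSolovejYngvason2005, ReedSimon1978]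

TWO-LAYER PLAN. Foreseen glued splits once a crux moves: EnergyVarianceDecay ⇐ (window c⁻² ≤ t ≤
ξ²·K inside the cluster radius, by expansion) → (t ≥ K ξ²: monotone/convexity structure of log Z
plus phonon kinematics) → EnergyVarianceDecay; SoftShellRelaxation ⇐ (occupation bound) → (variance
bound) → SoftShellRelaxation; HardModeBounds ⇐ (Ginibre cluster expansion for t ≤ Kξ², delivering
the bounds at t = Kξ²) → (propagation to t ≥ Kξ²) → HardModeBounds; TransportBookkeeping ⇐ (FK =
form semigroup, identification of lim E_t with groundStateEnergy) → (shell telescoping with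
CovarianceTransportLemma) → TransportBookkeeping. k ≤ 3 each, depth 1.

KILL CRITERIA. (i) A Bogoliubov-level (quadratic-Hamiltonian, exactly solvable) evaluation of the
flow from the particle vacuum showing that relaxed-shell number variances keep the pseudo-thermal
1/t² enhancement, or that Var_t(H) carries an extra power of L (L⁴ not L³), refutes
SoftShellRelaxation resp. EnergyVarianceDecay at the Gaussian level — close `refuted:<Decl>` (the
scheme, not a constant, is then wrong). (ii) A proof that Var_t(H) decays no faster than L³t⁻³ in d
= 3 kills EnergyVarianceDecay and the line. (iii) ¬NearMinimiserCoherence for some admissible v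
(degenerate Dirichlet ground states at all large N) forces a pivot of the target to "all ground
states" via flows from several initial states, not a close. (iv) FlowCondensation proved elsewhere
(any route giving condensing near-minimisers) moots cruxes 2–4 but completes this route's assembly.
A proof that C must depend on ρ does NOT kill anything: restate with (ρa³)^γ.

NOT DECOMPOSED YET. The semigroup/Feynman–Kac identification layer (FK expectation = Dirichlet-form
semigroup, strong differentiability, (log Z)'' = 4Var H, covariance identity for N_S, convergence
Φ_t/‖Φ_t‖ → Ψ₀) — it rides inside TransportBookkeeping and becomes layer-2 children or `--supports`
lemmas once a definition `BoseGas.heatFlow` lands (definition request below); the finite-time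
cluster expansion (card C3) as a separate statement; constants C, the threshold multiples of c⁻² and
1/(ck_j); positive temperature; the periodic variant (constant mode, no killing) which other routes
could share.

CHEAPEST FALSIFIER. Pen-and-paper/kit: run the whole scheme on the exactly solvable Bogoliubov
quadratic Hamiltonian (independent modes k, flow of the particle vacuum = anti-squeezed state with
λ_k = v_k/u_k): compute Var_t(H) = Σ_k 4ω_k² r_k/(1−r_k)², r_k = λ_k² e^{-4tω_k}, the shell
occupations and Var(N_{B_j}) at t ≥ 1/(ck_j), and check (a) Var_t(H) ≈ L³/(24π²c³t⁵) with NO extra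
power of L, (b) per-shell cost ∼ L³ck_j², (c) the dyadic sum is O(N√(ρa³)) uniformly in L. I did
(a)–(c) by hand while drafting (consistent: unrelaxed modes have 1 − r_k ≈ 4tω_k for t ≳ ξ², giving
1/(4t²) each; relaxed shells are quasi-free with u²v² ∼ (c/k)²); a refuter should redo it with the
Dirichlet mode sums (kit) — any L⁴ or log L found there retires the card's repaired scheme. Second
cheapest: PIGS/reptation-QMC measurement of Var_t(H)·t⁵/L³ for hard spheres at two box sizes.

NUMBERS. ħ = 2m = 1; c = √(16πρa) (Bogoliubov sound speed), κ = 1/ξ = √(8πρa), cξ = √2; flow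
thresholds t₀ = C c⁻² (= C ξ²/2) and T_j = C/(ck_j); Gaussian-level constant in C1: Var_t(H) ≈
L³/(24π² c³ t⁵) (Dirichlet octant mode count K³L³/(6π²)); shell cost 3C L³ck_j², Σ_j = 4C L³cκ² =
O(N√(ρa³)); hard-part transport cost 2√C C^{-3/4}(8π)^{3/4} N (ρa³)^{1/4}; LHY depletion scale
N√(ρa³) (FournaisSolovej2020); gap-based reach today: boxes L ≲ a(ρa³)^{-3/4-η} (Junge2026 Cor. 6).
Items at open: 9 (1 target, 3 cruxes, 4 support, 1 assembly).

DEFINITION REQUESTS. `BoseGas.heatFlow v N L t ψ₀ : Config N → ℂ` (topic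
Literature/MathematicalPhysics/QuantumManyBody): the Dirichlet N-body Schrödinger semigroup
e^{-tH_N} applied to ψ₀ ∈ L²(Λ_L^N), DEFINED by the Feynman–Kac formula used inline in cruxes 2–4 (N
independent Brownian motions `IsBrownianVec`/canonical `brownian`, diffusion √2·W for H = −Δ, killed
at ∂Λ_L, weight exp(−∫₀ᵗ interaction), weight 0 when the integral is ∞), with API: semigroup law,
positivity, symmetry preservation, L²-contraction, model-independence, Z(t) = ‖Φ_t‖² log-convex and
(log Z)'' = 4Var_t(H), identification of the generator's form with `energy` on TrialStates (form
core), Φ_t/‖Φ_t‖ → ground state. Filed with `ledger workitem add --kind definition --notion heatFlow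
--topic Literature/MathematicalPhysics/QuantumManyBody --for <TransportBookkeeping item>`; once it
lands the three flow cruxes can be restated in two lines each (tenure). No cite-fact requests: every
fact used is to be proved, and the Brownian existence facts the flow needs are already proved
(`RandomPlanarGeometry.exists_isBrownianReal_measurable_continuous_holds`).

Novelty: Searches (2026-08-15): `lit search --source crossref "imaginary time evolution local energy variance
decay ground state projection Bose"` (6 rows: quantum-algorithm ITE doi:10.1103/1tf6-bc55,
doi:10.1103/physrevresearch.7.013263; Fahy 1993 auxiliary-field projection
doi:10.1007/978-3-642-78448-4_11; lattice-Boltzmann GP numerics doi:10.1103/physreve.76.036712 —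
nothing rigorous, nothing on covariance transport); `lit search` local/hybrid index and `lit
vsearch`: service unavailable all session (searchd connection reset, D-0023 — retried 4×); `lit
search --source arxiv …`: HTTP 429; `lit galaxy search "imaginary time projection covariance
identity condensate" --star all`: panama 0 hits, pdf/crabby queue timeouts; plus the card's own
audited searches (crossref ×2, zbMATH ×1, refuter audit 13: ABK2006/AK2007 found, no
transport-of-ODLRO-along-imaginary-time found). `ledger idea list` (117 BEC cards) checked for
overlap: nearest in-pool are heating-only-depletes-thermal-bridge (thermal covariance sign
conjecture) and glauber-tensorisation-depletion (fictitious heat-bath gap) — different objects.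
Nearest prior art found: Ginibre1965 (doi:10.1063/1.1704275; Wiener-integral reduced density
matrices and cluster expansions — the finite-time engine); BaroniMoroni1999
(doi:10.1103/PhysRevLett.82.4745) and SarsaSchmidtMagro2000 (doi:10.1063/1.481926) — the same flow
e^{-tH}Φ₀ numerically, dE/dt = −2Var H and local-energy-variance decay as lore; AdamsBruKonig2006
(doi:10.1214/009117906000  [refs: 10.1103/1tf6-bc55, 10.1103/physrevresearch.7.013263, 10.1007/978-3-642-78448-4_11, 10.1103/physreve.76.036712, 10.1063/1.1704275, 10.1103/PhysRevLett.82.4745, 10.1063/1.481926, 10.1214/009117906000000214, 10.1007/s00440-007-0099-5, 10.1103/PhysRevLett.80.5040, 2603.20776, doi:10.1103/1tf6-bc55, doi:10.1103/physrevresearch.7.013263, doi:10.1007/978-3-642-78448-4_11, doi:10.1103/physreve.76.036712, ]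

Barriers (technique_class: heat-flow covariance-identity feynman-kac cluster-expansion): - technique_class: heat-flow covariance-identity feynman-kac cluster-expansion
- Literature.Barriers.AtomisticToContinuum.KineticGapLengthScales: evaded — no "gap × depletion ≤
excess energy" step; the passage finite object ⇒ ground state integrates an exact identity in t with
integrable σ_t(H); L enters only through the dyadic shell sum, uniform because ω_k is linear. Price
(honest): EnergyVarianceDecay is a two-sided spectral-measure statement about the product state.
- Literature.Barriers.AtomisticToContinuum.KineticGapLengthScalesNarrow: the Narrow form blocks
ENERGY-WINDOW arguments (input = an energy bound on the state only); here the input is the explicit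
state Φ_t with its full time-derivative structure, not an energy window;
FlowCondensation/NearMinimiserCoherence use energy windows only at FIXED N (compact resolvent),
where the barrier does not bite.
- Literature.Barriers.AtomisticToContinuum.EnergyAsymptoticsWithoutCondensation: evaded — nothing is
inferred from the VALUE of E₀ or of E_t; used is Var_t(H) = −Ė_t/2 of one explicit family; the
Lieb–Liniger witness is excluded because the d = 1 shell sum diverges (no claim in d = 1).
- Literature.Barriers.AtomisticToContinuum.EnergyAsymptoticsWithoutCondensationNarrow: same — no
two-order energy matching anywhere in the assembly.
- Literature.Barriers.AtomisticToContinuum.BogoliubovPerturbationInfrared: met by the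
`cluster-expansion` token and by the Bogoliubov orders that fix the shell times; evasion: the
expansion (

History (route lifecycle, newest last):
- 2026-08-15T13:39:01Z · CLOSED retired — not-a-thesis: assembly does not conclude the sub-problem Statement (operator:999:1257524)

sub-problem: BoseEinsteinCondensation · status: closed(retired) · opened planner-plancard-AtomisticToContinuum-BoseEin-4e560c3c-0 2026-08-15T11:41:26Z · rev 0 · ledger route-AtomisticToContinuum-BECImaginaryTimeTransport
GENERATED by the gate from the ledger (D-0016/17). Provers cite these decls: `theorem foo : Summit.AtomisticToContinuum.BoseEinsteinCondensation.Theses.BECImaginaryTimeTransport.<Decl> := …` in Summits/AtomisticToContinuum/BoseEinsteinCondensation/Theorems/<Name>.lean.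
-/

namespace Summit.AtomisticToContinuum.BoseEinsteinCondensation.Theses.BECImaginaryTimeTransport

open scoped BigOperators Topology Manifold Classical MeasureTheory ProbabilityTheory Matrix InnerProductSpace ComplexConjugate ContinuousMap
open Filter Set Function TopologicalSpace MeasureTheory

attribute [summit_statement] _root_.BoseEinsteinCondensation

/-- item stmt-AtomisticToContinuum-5521 · target · rank 0 · closed · moot by None · by planner
why it might fail: it is ground-state BEC itself for the Perron–Frobenius ground state (open 75+ years); fails if the thermodynamic-limit ground state of some admissible v at small ρ is a fragmented/quantum-solid state.
sources: LiebSeiringerSolovejYngvason2005, Junge2026, arXiv:2510.20493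
[target] X_T's flow-free typed consequence: for every repulsive finite-range v there is ρ₀ > 0 such
that for 0 < ρ < ρ₀ there is c > 0 with, for all large N, ONE normalised measurable mode u such that
for every δ > 0 some δ-near-minimiser Ψ of the Dirichlet N-body energy in the box of side
(N/ρ)^{1/3} has ⟨u, γ_Ψ u⟩ ≥ cN (the ground state reached by the flow condenses; u = the one-body
Dirichlet ground mode in the intended proof). -/
@[route_item "route-AtomisticToContinuum-BECImaginaryTimeTransport"]
def FlowCondensation : Prop :=
  ∀ v : ℝ → ENNReal, Literature.MathematicalPhysics.QuantumManyBody.BoseGas.IsRepulsiveFiniteRange v → ∃ ρ₀ : ℝ, 0 < ρ₀ ∧ ∀ ρ : ℝ, 0 < ρ → ρ < ρ₀ → ∃ c : ℝ, 0 < c ∧ ∀ᶠ N : ℕ in Filter.atTop, ∃ u : EuclideanSpace ℝ (Fin 3) → ℂ, MeasureTheory.AEStronglyMeasurable u MeasureTheory.volume ∧ (∫⁻ x, (‖u x‖₊ : ENNReal) ^ 2) = 1 ∧ ∀ δ : ENNReal, 0 < δ → ∃ Ψ : Literature.MathematicalPhysics.QuantumManyBody.BoseGas.TrialState N (Literature.MathematicalPhysics.QuantumManyBody.BoseGas.sideLength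 ρ N), Literature.MathematicalPhysics.QuantumManyBody.BoseGas.energy v Ψ ≤ Literature.MathematicalPhysics.QuantumManyBody.BoseGas.groundStateEnergy v N (Literature.MathematicalPhysics.QuantumManyBody.BoseGas.sideLength ρ N) + δ ∧ ENNReal.ofReal (c * N) ≤ Literature.MathematicalPhysics.QuantumManyBody.BoseGas.occupation N u Ψ.ψ

/-- item stmt-AtomisticToContinuum-5522 · crux · rank 2 · closed · moot by None · by planner
why it might fail: a two-sided statement on the spectral measure of the product state far beyond the cluster radius ρat ≲ 1; an anomalously slow non-phonon soft branch, or L-dependent prefactors (L⁴ instead of L³) from condensate-number fluctuations, would break it.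
sources: BaroniMoroni1999, SarsaSchmidtMagro2000, GiorginiPitaevskiiStringari1998, LiebSeiringerSolovejYngvason2005, Ginibre1965
[crux] (card C1) ENERGY-VARIANCE DECAY ALONG THE FLOW. For every repulsive finite-range v there are
C, ρ₀ > 0 such that for 0 < ρ < ρ₀, all large N and EVERY 3N-dimensional Brownian model W: with L =
(N/ρ)^{1/3}, c = √(16πρa), Φ_t(X) = E[1{X+√2W_s ∈ Λ_L^N ∀s≤t} · exp(−∫₀ᵗ Σ_{i<j}
v(|x_i−x_j|)(X+√2W_s) ds) · Φ₀(X+√2W_t)] (killed on hard cores: weight 0 when the time integral is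
∞), Φ₀ = ∏ √(2/L) sin(πx_{ik}/L), and Z(t) = ‖Φ_t‖²₂: for all t ≥ C c⁻², Var_t(H) = ¼ (log Z)''(t) ≤
C L³ c⁻³ t⁻⁵. (Bogoliubov heuristic: each unrelaxed phonon mode ck ≲ 1/t is pseudo-thermal at T_eff
= 1/(4t) and contributes 1/(4t²); there are ∼ (L/(ct))³ of them.) [difficulty: XL] -/
@[route_item "route-AtomisticToContinuum-BECImaginaryTimeTransport"]
def EnergyVarianceDecay : Prop :=
  ∀ v : ℝ → ENNReal, Literature.MathematicalPhysics.QuantumManyBody.BoseGas.IsRepulsiveFiniteRange v → ∃ C ρ₀ : ℝ, 0 < ρ₀ ∧ ∀ ρ : ℝ, 0 < ρ → ρ < ρ₀ → ∀ᶠ N : ℕ in Filter.atTop, ∀ (Ω : Type) [MeasurableSpace Ω] (P : MeasureTheory.Measure Ω) (W : NNReal → Ω → (Fin (N * 3) → ℝ)), Literature.Probability.Process.IsBrownianVec W P → let L : ℝ := Literature.MathematicalPhysics.QuantumManyBody.BoseGas.sideLength ρ N; let a : ℝ := (Literature.MathematicalPhysics.QuantumManyBody.BoseGas.scatteringLength v).toReal;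 let c : ℝ := Real.sqrt (16 * Real.pi * ρ * a); let pos : Literature.MathematicalPhysics.QuantumManyBody.BoseGas.Config N → ℝ → Ω → Literature.MathematicalPhysics.QuantumManyBody.BoseGas.Config N := fun X s ω i => X i + Real.sqrt 2 • (WithLp.toLp 2 (fun k : Fin 3 => W s.toNNReal ω (finProdFinEquiv (i, k))) : EuclideanSpace ℝ (Fin 3)); let Φ : ℝ → Literature.MathematicalPhysics.QuantumManyBody.BoseGas.Config N → ℝ := fun t X => ∫ ω, (if ∀ s : ℝ, 0 ≤ s → s ≤ t → pos X s ω ∈ Literature.MathematicalPhysics.QuantumManyBody.BoseGas.boxN N L then (1 : ℝ) else 0) * (if (∫⁻ s in Set.Icc 0 t, Literature.MathematicalPhysics.QuantumManyBody.BoseGas.interaction v (pos X s ω)) = ⊤ then (0 : ℝ) else Real.exp (-(∫⁻ s in Set.Icc 0 t, Literature.MathematicalPhysics.QuantumManyBody.BoseGas.interaction v (pos X s ω)).toReal)) * (∏ i : Fin N, ∏ k : Fin 3, Real.sqrt (2 / L) * Real.sin (Real.pi * pos X t ω i k / L)) ∂P; let Z : ℝ → ℝ := fun t => ∫ X, Φ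 t X ^ 2; ∀ t : ℝ, 0 < t → C * c⁻¹ ^ 2 ≤ t → deriv^[2] (fun s => Real.log (Z s)) t / 4 ≤ C * L ^ 3 * c⁻¹ ^ 3 * t⁻¹ ^ 5

/-- item stmt-AtomisticToContinuum-5523 · crux · rank 3 · closed · moot by None · by planner
why it might fail: needs Bogoliubov-size occupations AND normal (non-pseudo-thermal) number variances of every relaxed shell of an explicit but non-perturbative state, uniformly down to k ∼ π/L; inter-shell coupling through the still-unrelaxed lower shells could inflate variances.
sources: GiorginiPitaevskiiStringari1998, LiebSeiringerSolovejYngvason2005, FournaisSolovej2020, Junge2026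
[crux] (card C2, soft part) SHELL RELAXATION STATISTICS. Same flow (N = M+2 ≥ 2), κ = √(8πρa),
Dirichlet sine modes φ_n (n ∈ ℕ₊³, |k_n| = π|n|/L), dyadic shells B_j = {n ≠ (1,1,1) : k_j/2 < |k_n|
≤ k_j}, k_j = 2⁻ʲκ: for every j, every finite S ⊆ B_j and all t ≥ C/(ck_j): ⟨N_S⟩_t ≤ C L³ c k_j²
and ⟨N_S²⟩_t ≤ ⟨N_S⟩_t² + C L³ c² k_j, where N_S = Σ_i P_S^{(i)} is written through `occupation`
(one-body) and the explicit two-body pair occupation, both normalised by Z(t). [difficulty: XL] -/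
@[route_item "route-AtomisticToContinuum-BECImaginaryTimeTransport"]
def SoftShellRelaxation : Prop :=
  ∀ v : ℝ → ENNReal, Literature.MathematicalPhysics.QuantumManyBody.BoseGas.IsRepulsiveFiniteRange v → ∃ C ρ₀ : ℝ, 0 < ρ₀ ∧ ∀ ρ : ℝ, 0 < ρ → ρ < ρ₀ → ∀ᶠ M : ℕ in Filter.atTop, ∀ (Ω : Type) [MeasurableSpace Ω] (P : MeasureTheory.Measure Ω) (W : NNReal → Ω → (Fin ((M + 2) * 3) → ℝ)), Literature.Probability.Process.IsBrownianVec W P → let L : ℝ := Literature.MathematicalPhysics.QuantumManyBody.BoseGas.sideLength ρ (M + 2); let a : ℝ := (Literature.MathematicalPhysics.QuantumManyBody.BoseGas.scatteringLength v).toReal; let c : ℝ := Real.sqrt (16 * Real.pi * ρ * a); let κ : ℝ := Real.sqrt (8 * Real.pi * ρ * a); let pos : Literature.MathematicalPhysics.QuantumManyBody.BoseGas.Config (M + 2) → ℝ → Ω → Literature.MathematicalPhysics.QuantumManyBody.BoseGas.Config (M + 2) := fun X s ω i => X i + Real.sqrt 2 • (WithLp.toLp 2 (fun k : Fin 3 =>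 W s.toNNReal ω (finProdFinEquiv (i, k))) : EuclideanSpace ℝ (Fin 3)); let Φ : ℝ → Literature.MathematicalPhysics.QuantumManyBody.BoseGas.Config (M + 2) → ℝ := fun t X => ∫ ω, (if ∀ s : ℝ, 0 ≤ s → s ≤ t → pos X s ω ∈ Literature.MathematicalPhysics.QuantumManyBody.BoseGas.boxN (M + 2) L then (1 : ℝ) else 0) * (if (∫⁻ s in Set.Icc 0 t, Literature.MathematicalPhysics.QuantumManyBody.BoseGas.interaction v (pos X s ω)) = ⊤ then (0 : ℝ) else Real.exp (-(∫⁻ s in Set.Icc 0 t, Literature.MathematicalPhysics.QuantumManyBody.BoseGas.interaction v (pos X s ω)).toReal)) * (∏ i : Fin (M + 2), ∏ k : Fin 3, Real.sqrt (2 / L) * Real.sin (Real.pi * pos X t ω i k / L)) ∂P; let Z : ℝ → ℝ := fun t => ∫ X, Φ t X ^ 2; let mode : (Fin 3 → ℕ) → EuclideanSpace ℝ (Fin 3) → ℂ := fun n x => ((∏ k : Fin 3, Real.sqrt (2 / L) * Real.sin (Real.pi * (n k) * x k / L) : ℝ) : ℂ); let kn : (Fin 3 → ℕ) → ℝ :=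 fun n => Real.pi * Real.sqrt (∑ k : Fin 3, ((n k : ℕ) : ℝ) ^ 2) / L; let occ : Finset (Fin 3 → ℕ) → ℝ → ENNReal := fun S t => (∑ n ∈ S, Literature.MathematicalPhysics.QuantumManyBody.BoseGas.occupation (M + 2) (mode n) (fun X => (Φ t X : ℂ))) / ENNReal.ofReal (Z t); let pair : Finset (Fin 3 → ℕ) → ℝ → ENNReal := fun S t => ((M + 2 : ENNReal) * (M + 1)) * (∑ n ∈ S, ∑ m ∈ S, ∫⁻ Y : Literature.MathematicalPhysics.QuantumManyBody.BoseGas.Config M, (‖∫ x : EuclideanSpace ℝ (Fin 3), ∫ y : EuclideanSpace ℝ (Fin 3), conj (mode n x) * conj (mode m y) * (Φ t (Matrix.vecCons x (Matrix.vecCons y Y)) : ℂ)‖₊ : ENNReal) ^ 2) / ENNReal.ofReal (Z t); ∀ j : ℕ, ∀ S : Finset (Fin 3 → ℕ), (∀ n ∈ S, (∀ k, 1 ≤ n k) ∧ n ≠ (fun _ => 1) ∧ κ * 2⁻¹ ^ j / 2 < kn n ∧ kn n ≤ κ * 2⁻¹ ^ j) → ∀ t : ℝ, 0 < t → C * (c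 * (κ * 2⁻¹ ^ j))⁻¹ ≤ t → occ S t ≤ ENNReal.ofReal (C * L ^ 3 * c * (κ * 2⁻¹ ^ j) ^ 2) ∧ occ S t + pair S t ≤ occ S t ^ 2 + ENNReal.ofReal (C * L ^ 3 * c ^ 2 * (κ * 2⁻¹ ^ j))

/-- item stmt-AtomisticToContinuum-5524 · crux · rank 4 · closed · moot by None · by planner
why it might fail: uniformity in t beyond the cluster-expansion radius ρat ≲ 1 is unproved; the LHY-size depletion N√(ρa³) of the hard modes must not be transiently exceeded while the soft shells relax.
sources: Ginibre1965, AdamsBruKonig2006, FournaisSolovej2020, LiebSeiringerSolovejYngvason2005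
[crux] (card C2 hard part / C3 output) HARD-MODE BOUNDS. Same flow and modes: for every finite S ⊆
{n ≠ (1,1,1) : |k_n| > κ} and all t ≥ C c⁻²: ⟨N_S⟩_t ≤ C N √(ρa³) and ⟨N_S²⟩_t ≤ ⟨N_S⟩_t² + C N.
Expected mechanism up to t ≈ ξ²: a Ginibre-type cluster expansion of the 2t-long interacting
Brownian paths with product initial law (small parameter = expected number of distinct partners met
= ρat, Boltzmann statistics — no permutations since Φ₀ is symmetric), which also yields E_t to LHY
precision; beyond ξ² an a-priori bound. [difficulty: XL] -/
@[route_item "route-AtomisticToContinuum-BECImaginaryTimeTransport"]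
def HardModeBounds : Prop :=
  ∀ v : ℝ → ENNReal, Literature.MathematicalPhysics.QuantumManyBody.BoseGas.IsRepulsiveFiniteRange v → ∃ C ρ₀ : ℝ, 0 < ρ₀ ∧ ∀ ρ : ℝ, 0 < ρ → ρ < ρ₀ → ∀ᶠ M : ℕ in Filter.atTop, ∀ (Ω : Type) [MeasurableSpace Ω] (P : MeasureTheory.Measure Ω) (W : NNReal → Ω → (Fin ((M + 2) * 3) → ℝ)), Literature.Probability.Process.IsBrownianVec W P → let L : ℝ := Literature.MathematicalPhysics.QuantumManyBody.BoseGas.sideLength ρ (M + 2); let a : ℝ := (Literature.MathematicalPhysics.QuantumManyBody.BoseGas.scatteringLength v).toReal; let c : ℝ := Real.sqrt (16 * Real.pi * ρ * a); let κ : ℝ := Real.sqrt (8 * Real.pi * ρ * a); let pos : Literature.MathematicalPhysics.QuantumManyBody.BoseGas.Config (M + 2) → ℝ → Ω → Literature.MathematicalPhysics.QuantumManyBody.BoseGas.Config (M + 2) := fun X s ω i => X i + Real.sqrt 2 • (WithLp.toLp 2 (fun k : Fin 3 => W s.toNNReal ω (finProdFinEquiv (i, k))) : EuclideanSpace ℝ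 (Fin 3)); let Φ : ℝ → Literature.MathematicalPhysics.QuantumManyBody.BoseGas.Config (M + 2) → ℝ := fun t X => ∫ ω, (if ∀ s : ℝ, 0 ≤ s → s ≤ t → pos X s ω ∈ Literature.MathematicalPhysics.QuantumManyBody.BoseGas.boxN (M + 2) L then (1 : ℝ) else 0) * (if (∫⁻ s in Set.Icc 0 t, Literature.MathematicalPhysics.QuantumManyBody.BoseGas.interaction v (pos X s ω)) = ⊤ then (0 : ℝ) else Real.exp (-(∫⁻ s in Set.Icc 0 t, Literature.MathematicalPhysics.QuantumManyBody.BoseGas.interaction v (pos X s ω)).toReal)) * (∏ i : Fin (M + 2), ∏ k : Fin 3, Real.sqrt (2 / L) * Real.sin (Real.pi * pos X t ω i k / L)) ∂P; let Z : ℝ → ℝ := fun t => ∫ X, Φ t X ^ 2; let mode : (Fin 3 → ℕ) → EuclideanSpace ℝ (Fin 3) → ℂ := fun n x => ((∏ k : Fin 3, Real.sqrt (2 / L) * Real.sin (Real.pi * (n k) * x k / L) : ℝ) : ℂ); let kn : (Fin 3 → ℕ) → ℝ := fun n => Real.pi * Real.sqrt (∑ k : Fin 3, ((n k : ℕ) :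 ℝ) ^ 2) / L; let occ : Finset (Fin 3 → ℕ) → ℝ → ENNReal := fun S t => (∑ n ∈ S, Literature.MathematicalPhysics.QuantumManyBody.BoseGas.occupation (M + 2) (mode n) (fun X => (Φ t X : ℂ))) / ENNReal.ofReal (Z t); let pair : Finset (Fin 3 → ℕ) → ℝ → ENNReal := fun S t => ((M + 2 : ENNReal) * (M + 1)) * (∑ n ∈ S, ∑ m ∈ S, ∫⁻ Y : Literature.MathematicalPhysics.QuantumManyBody.BoseGas.Config M, (‖∫ x : EuclideanSpace ℝ (Fin 3), ∫ y : EuclideanSpace ℝ (Fin 3), conj (mode n x) * conj (mode m y) * (Φ t (Matrix.vecCons x (Matrix.vecCons y Y)) : ℂ)‖₊ : ENNReal) ^ 2) / ENNReal.ofReal (Z t); ∀ S : Finset (Fin 3 → ℕ), (∀ n ∈ S, (∀ k, 1 ≤ n k) ∧ n ≠ (fun _ => 1) ∧ κ < kn n) → ∀ t : ℝ, 0 < t → C * c⁻¹ ^ 2 ≤ t → occ S t ≤ ENNReal.ofReal (C * (M + 2) * Real.sqrt (ρ * a ^ 3)) ∧ occ S t + pair S t ≤ occ S t ^ 2 + ENNReal.ofReal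 (C * (M + 2))

/-- item stmt-AtomisticToContinuum-5525 · support · rank 9 · closed · moot by None · by planner
sources: BaroniMoroni1999, LiebSeiringerSolovejYngvason2005
[support] (card S1, abstract engine) finite-dimensional covariance transport: for self-adjoint H, A
on a finite-dimensional complex Hilbert space and Φ_t = e^{-tH}Φ₀ (Φ₀ ≠ 0), the normalised
expectation ⟨A⟩_t satisfies |⟨A⟩_{T₂} − ⟨A⟩_{T₁}| ≤ 2∫_{T₁}^{T₂} σ_t(H)σ_t(A) dt (d⟨A⟩_t/dt = −2Re
Cov_t(H,A) and Cauchy–Schwarz). [difficulty: provable-now] -/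
@[route_item "route-AtomisticToContinuum-BECImaginaryTimeTransport"]
def CovarianceTransportLemma : Prop :=
  ∀ (E : Type) [NormedAddCommGroup E] [InnerProductSpace ℂ E] [FiniteDimensional ℂ E] (H A : E →L[ℂ] E), IsSelfAdjoint H → IsSelfAdjoint A → ∀ Φ₀ : E, Φ₀ ≠ 0 → let Φ : ℝ → E := fun t => NormedSpace.exp (-((t : ℂ) • H)) Φ₀; let avg : (E →L[ℂ] E) → ℝ → ℝ := fun B t => (⟪Φ t, B (Φ t)⟫_ℂ).re / ‖Φ t‖ ^ 2; ∀ T₁ T₂ : ℝ, 0 ≤ T₁ → T₁ ≤ T₂ → |avg A T₂ - avg A T₁| ≤ 2 * ∫ t in T₁..T₂, Real.sqrt (avg (H * H) t - avg H t ^ 2) * Real.sqrt (avg (A * A) t - avg A t ^ 2)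

/-- item stmt-AtomisticToContinuum-5526 · support · rank 9 · closed · moot by None · by planner
sources: arXiv:2511.20118, Kallenberg2002
[support] non-vacuity of the flow cruxes (they quantify over all models): for every d there is a
probability space carrying a d-dimensional Brownian motion in the sense of `IsBrownianVec` (product
of d canonical Wiener spaces, as `BrownianVecModel` does for d = 4). [difficulty: provable-now] -/
@[route_item "route-AtomisticToContinuum-BECImaginaryTimeTransport"]
def BrownianModelExists : Prop :=
  ∀ d : ℕ, ∃ (Ω : Type) (_ : MeasurableSpace Ω) (P : MeasureTheory.Measure Ω) (W : NNReal → Ω → (Fin d → ℝ)), MeasureTheory.IsProbabilityMeasure P ∧ Literature.Probability.Process.IsBrownianVec W P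

/-- item stmt-AtomisticToContinuum-5527 · support · rank 9 · closed · moot by None · by planner
sources: LiebSeiringerSolovejYngvason2005, ReedSimon1978
[support] (card S2, identification) at fixed large N and small ρ the Dirichlet ground state is
unique and near-minimisers are stable: for every normalised measurable mode u and ε > 0 there is δ >
0 such that any two δ-near-minimisers have u-occupations within εN (E₀ < ⊤ by disjoint bumps;
compact resolvent; positivity-improving FK semigroup on the uncaged component; occupation is
2N-Lipschitz in L²). [difficulty: M] -/
@[route_item "route-AtomisticToContinuum-BECImaginaryTimeTransport"]
def NearMinimiserCoherence : Prop :=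
  ∀ v : ℝ → ENNReal, Literature.MathematicalPhysics.QuantumManyBody.BoseGas.IsRepulsiveFiniteRange v → ∃ ρ₀ : ℝ, 0 < ρ₀ ∧ ∀ ρ : ℝ, 0 < ρ → ρ < ρ₀ → ∀ᶠ N : ℕ in Filter.atTop, ∀ u : EuclideanSpace ℝ (Fin 3) → ℂ, MeasureTheory.AEStronglyMeasurable u MeasureTheory.volume → (∫⁻ x, (‖u x‖₊ : ENNReal) ^ 2) = 1 → ∀ ε : ℝ, 0 < ε → ∃ δ : ENNReal, 0 < δ ∧ ∀ Ψ Ψ' : Literature.MathematicalPhysics.QuantumManyBody.BoseGas.TrialState N (Literature.MathematicalPhysics.QuantumManyBody.BoseGas.sideLength ρ N), Literature.MathematicalPhysics.QuantumManyBody.BoseGas.energy v Ψ ≤ Literature.MathematicalPhysics.QuantumManyBody.BoseGas.groundStateEnergy v N (Literature.MathematicalPhysics.QuantumManyBody.BoseGas.sideLength ρ N) + δ → Literature.MathematicalPhysics.QuantumManyBody.BoseGas.energy v Ψ' ≤ Literature.MathematicalPhysics.QuantumManyBody.BoseGas.groundStateEnergy v N (Literature.MathematicalPhysics.QuantumManyBody.BoseGas.sideLength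 ρ N) + δ → Literature.MathematicalPhysics.QuantumManyBody.BoseGas.occupation N u Ψ.ψ ≤ Literature.MathematicalPhysics.QuantumManyBody.BoseGas.occupation N u Ψ'.ψ + ENNReal.ofReal (ε * N)

/-- item stmt-AtomisticToContinuum-5528 · support · rank 9 · closed · moot by None · by planner
sources: Ginibre1965, LiebSeiringerSolovejYngvason2005, ReedSimon1978
[support] (card S1+S2, the bookkeeping theorem) EnergyVarianceDecay → SoftShellRelaxation →
HardModeBounds → FlowCondensation: the FK expectation is the Dirichlet-form semigroup e^{-tH_N}Φ₀
(so (log Z)'' = 4Var_t(H), d⟨N_S⟩_t/dt = −2Re Cov_t(H,N_S)); apply CovarianceTransportLemma (via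
spectral truncation / dominated convergence) to each shell from max(T_j, Cc⁻²) and to the hard part,
telescope N = N_u + Σ_j N_{B_j} + N_hard over the sine basis (u = φ_(1,1,1)), sum the geometric
series Σ_j L³ck_j² = O(N√(ρa³)) plus the hard cost O(N(ρa³)^{1/4}), let t → ∞ (Φ_t/‖Φ_t‖ → Ψ₀, E_t ↓
groundStateEnergy since ⟨Φ₀,Ψ₀⟩ > 0 and the C¹ Dirichlet class is a form core), and approximate Ψ₀
in form norm by TrialStates. Instantiate the ∀-model cruxes with BrownianModelExists. [difficulty:
XL] -/
@[route_item "route-AtomisticToContinuum-BECImaginaryTimeTransport"]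
def TransportBookkeeping : Prop :=
  EnergyVarianceDecay → SoftShellRelaxation → HardModeBounds → FlowCondensation

/-- item stmt-AtomisticToContinuum-5529 · assembly · rank 1 · closed · moot by None · by planner
sources: LiebSeiringerSolovejYngvason2005
[assembly] FlowCondensation → NearMinimiserCoherence → BoseEinsteinCondensation. -/
@[route_item "route-AtomisticToContinuum-BECImaginaryTimeTransport"]
def Assembly : Prop :=
  FlowCondensation → NearMinimiserCoherence → Literature.MathematicalPhysics.QuantumManyBody.BoseGas.BoseEinsteinCondensation

end Summit.AtomisticToContinuum.BoseEinsteinCondensation.Theses.BECImaginaryTimeTransport
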